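import Mathlib
import HarnessLib
import HarnessLib.Audit
import Summits.Langlands.Statement
import Summits.Langlands.Langlands.Theses.ParahoricFibre
import Literature.NumberTheory.GaloisRepresentations.WeilDeligneRepFrobSemisimpleProofs
import Literature.NumberTheory.GaloisRepresentations.WeilDeligneOfGaloisExistence
import Literature.NumberTheory.GaloisRepresentations.GrothendieckDeligneWeilDeligneExistenceHolds
import Summits.Langlands.Langlands.Theses.MonodromyRankLadder

/-! BC3 birth skeleton for crux `DepthRungs` of the child route MonodromyRankLadder (lens-3 g18) — POST-birth form (concludes the ROUTE decl by name).
Line «semistable reduction»: stub₁ = the crux in the SEMISTABLE case (inertia acts trivially on the Frobenius-semisimplified Weil–Deligne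
representation: ρ|Γ_v unipotent on inertia — Taylor normal form), stub₂ = the reduction of the general case to it (solvable CM base change making
ρ|I_w unipotent and π_w Iwahori-spherical, Arthur–Clozel + cuspidal constituents + genericity of unitary isobaric sums; Taylor–Yoshida §1 first move).
Composition `DepthRungs_of` is modus ponens (the seam is trivial; both stubs are genuine: stub₁ is the open core, stub₂ is print-level but M-sized to type). -/

set_option linter.unusedVariables false
set_option linter.dupNamespace false

namespace Summit.Langlands.Langlands.Cruxes.DepthRungs.Birth

/-- stub₁: the semistable (inertially trivial W′) case of `DepthRungs`. -/
theorem stub_depthRungs_semistable :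
  open IsDedekindDomain NumberField Polynomial Filter Literature.NumberTheory.Automorphic Literature.NumberTheory.GaloisRepresentations in ∀ (K : Type) [Field K] [NumberField K], NumberField.IsCMField K → ∀ (n : ℕ) (hcpt : isCompact_glFiniteIntegralLevel n K) (π : CuspidalAutomorphicRepData n K hcpt), π.1.IsRegularAlgebraic → ∀ (p : ℕ) [Fact p.Prime] (ι : PadicAlgCl p ≃+* ℂ) (ρ : FramedGaloisRep K (PadicAlgCl p) n), ρ.toGaloisRep.IsSemisimple → (∀ᶠ v : HeightOneSpectrum (𝓞 K) in cofinite, ∀ α : Multiset ℂ, π.1.HasSatakeParamAt v α → ρ.IsUnramifiedAt v ∧ ρ.HasFrobCharpolyAt v (arithFrobPolyOfSatake ι v.residueCard n α)) → ¬ (n ^ 2 < p ∧ ¬ ((p : ℤ) ∣ NumberField.discr K) ∧ (∀ w : HeightOneSpectrum (𝓞 K), ((p : ℕ) : 𝓞 K) ∈ w.asIdeal → π.1.IsUnramifiedAt w) ∧ (∃ g : GL (Fin n) (PadicAlgCl p), (∀ (σ : Field.absoluteGaloisGroup K) (i j : Fin n), ‖((g * ρ σ * g⁻¹ : GL (Fin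 n) (PadicAlgCl p)) : Matrix (Fin n) (Fin n) (PadicAlgCl p)) i j‖ ≤ 1) ∧ (∀ M : Matrix (Fin n) (Fin n) ℤ, M.det = 1 → ∃ σ : Field.absoluteGaloisGroup K, ∀ i j : Fin n, ‖((g * ρ σ * g⁻¹ : GL (Fin n) (PadicAlgCl p)) : Matrix (Fin n) (Fin n) (PadicAlgCl p)) i j - ((M i j : ℤ) : PadicAlgCl p)‖ < 1)) ∧ (∃ l : ℕ, l.Prime ∧ l ≠ p ∧ ∀ w : HeightOneSpectrum (𝓞 K), ((l : ℕ) : 𝓞 K) ∈ w.asIdeal → w.residueCard = l ∧ ρ.IsUnramifiedAt w ∧ ∃ a : Fin n → PadicAlgCl p, ρ.HasFrobCharpolyAt w (∏ i, (X - C (a i))) ∧ ∀ i j : Fin n, i ≠ j → ‖a i - a j‖ = 1 ∧ ‖a i - (l : PadicAlgCl p) * a j‖ = 1)) → ∀ v : HeightOneSpectrum (𝓞 K), ((p : ℕ) : 𝓞 K) ∉ v.asIdeal → ∀ W : WeilDeligneRep (v.adicCompletion K) (PadicAlgCl p) (Fin n → PadicAlgCl p), IsWeilDeligneOfLadic (ρ.toLocal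 v).toWeilGroupHom W → ∀ W' : WeilDeligneRep (v.adicCompletion K) (PadicAlgCl p) (Fin n → PadicAlgCl p), W'.IsFrobSemisimplificationOf W → (∀ u : WeilGroup (v.adicCompletion K), u ∈ WeilGroup.inertia (v.adicCompletion K) → W'.ρ u = 1) → (∀ W'' : WeilDeligneRep (v.adicCompletion K) (PadicAlgCl p) (Fin n → PadicAlgCl p), W''.ρ = W'.ρ → Module.finrank (PadicAlgCl p) (LinearMap.range W''.N) ≤ Module.finrank (PadicAlgCl p) (LinearMap.range W'.N)) → ∀ W'' : WeilDeligneRep (v.adicCompletion K) (PadicAlgCl p) (Fin n → PadicAlgCl p), W''.ρ = W'.ρ → ∀ k : ℕ, 2 ≤ k → Module.finrank (PadicAlgCl p) (LinearMap.range (W''.N ^ k)) ≤ Module.finrank (PadicAlgCl p) (LinearMap.range (W'.N ^ k)) := by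
  sorry

/-- stub₂: reduction of `DepthRungs` to its semistable case (solvable base change). -/
theorem stub_depthRungs_reduction :
  (open IsDedekindDomain NumberField Polynomial Filter Literature.NumberTheory.Automorphic Literature.NumberTheory.GaloisRepresentations in ∀ (K : Type) [Field K] [NumberField K], NumberField.IsCMField K → ∀ (n : ℕ) (hcpt : isCompact_glFiniteIntegralLevel n K) (π : CuspidalAutomorphicRepData n K hcpt), π.1.IsRegularAlgebraic → ∀ (p : ℕ) [Fact p.Prime] (ι : PadicAlgCl p ≃+* ℂ) (ρ : FramedGaloisRep K (PadicAlgCl p) n), ρ.toGaloisRep.IsSemisimple → (∀ᶠ v : HeightOneSpectrum (𝓞 K) in cofinite, ∀ α : Multiset ℂ, π.1.HasSatakeParamAt v α → ρ.IsUnramifiedAt v ∧ ρ.HasFrobCharpolyAt v (arithFrobPolyOfSatake ι v.residueCard n α)) → ¬ (n ^ 2 < p ∧ ¬ ((p : ℤ) ∣ NumberField.discr K) ∧ (∀ w : HeightOneSpectrum (𝓞 K), ((p : ℕ) : 𝓞 K) ∈ w.asIdeal → π.1.IsUnramifiedAt w) ∧ (∃ g : GL (Fin n) (PadicAlgCl p),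 (∀ (σ : Field.absoluteGaloisGroup K) (i j : Fin n), ‖((g * ρ σ * g⁻¹ : GL (Fin n) (PadicAlgCl p)) : Matrix (Fin n) (Fin n) (PadicAlgCl p)) i j‖ ≤ 1) ∧ (∀ M : Matrix (Fin n) (Fin n) ℤ, M.det = 1 → ∃ σ : Field.absoluteGaloisGroup K, ∀ i j : Fin n, ‖((g * ρ σ * g⁻¹ : GL (Fin n) (PadicAlgCl p)) : Matrix (Fin n) (Fin n) (PadicAlgCl p)) i j - ((M i j : ℤ) : PadicAlgCl p)‖ < 1)) ∧ (∃ l : ℕ, l.Prime ∧ l ≠ p ∧ ∀ w : HeightOneSpectrum (𝓞 K), ((l : ℕ) : 𝓞 K) ∈ w.asIdeal → w.residueCard = l ∧ ρ.IsUnramifiedAt w ∧ ∃ a : Fin n → PadicAlgCl p, ρ.HasFrobCharpolyAt w (∏ i, (X - C (a i))) ∧ ∀ i j : Fin n, i ≠ j → ‖a i - a j‖ = 1 ∧ ‖a i - (l : PadicAlgCl p) * a j‖ = 1)) → ∀ v : HeightOneSpectrum (𝓞 K), ((p : ℕ) : 𝓞 K) ∉ v.asIdeal → ∀ W : WeilDeligneRep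 (v.adicCompletion K) (PadicAlgCl p) (Fin n → PadicAlgCl p), IsWeilDeligneOfLadic (ρ.toLocal v).toWeilGroupHom W → ∀ W' : WeilDeligneRep (v.adicCompletion K) (PadicAlgCl p) (Fin n → PadicAlgCl p), W'.IsFrobSemisimplificationOf W → (∀ u : WeilGroup (v.adicCompletion K), u ∈ WeilGroup.inertia (v.adicCompletion K) → W'.ρ u = 1) → (∀ W'' : WeilDeligneRep (v.adicCompletion K) (PadicAlgCl p) (Fin n → PadicAlgCl p), W''.ρ = W'.ρ → Module.finrank (PadicAlgCl p) (LinearMap.range W''.N) ≤ Module.finrank (PadicAlgCl p) (LinearMap.range W'.N)) → ∀ W'' : WeilDeligneRep (v.adicCompletion K) (PadicAlgCl p) (Fin n → PadicAlgCl p), W''.ρ = W'.ρ → ∀ k : ℕ, 2 ≤ k → Module.finrank (PadicAlgCl p) (LinearMap.range (W''.N ^ k)) ≤ Module.finrank (PadicAlgCl p) (LinearMap.range (W'.N ^ k))) → (open IsDedekindDomain NumberField Polynomial Filter Literature.NumberTheory.Automorphic Literature.NumberTheory.GaloisRepresentations in ∀ (K : Type) [Field K] [NumberField K], NumberField.IsCMField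 K → ∀ (n : ℕ) (hcpt : isCompact_glFiniteIntegralLevel n K) (π : CuspidalAutomorphicRepData n K hcpt), π.1.IsRegularAlgebraic → ∀ (p : ℕ) [Fact p.Prime] (ι : PadicAlgCl p ≃+* ℂ) (ρ : FramedGaloisRep K (PadicAlgCl p) n), ρ.toGaloisRep.IsSemisimple → (∀ᶠ v : HeightOneSpectrum (𝓞 K) in cofinite, ∀ α : Multiset ℂ, π.1.HasSatakeParamAt v α → ρ.IsUnramifiedAt v ∧ ρ.HasFrobCharpolyAt v (arithFrobPolyOfSatake ι v.residueCard n α)) → ¬ (n ^ 2 < p ∧ ¬ ((p : ℤ) ∣ NumberField.discr K) ∧ (∀ w : HeightOneSpectrum (𝓞 K), ((p : ℕ) : 𝓞 K) ∈ w.asIdeal → π.1.IsUnramifiedAt w) ∧ (∃ g : GL (Fin n) (PadicAlgCl p), (∀ (σ : Field.absoluteGaloisGroup K) (i j : Fin n), ‖((g * ρ σ * g⁻¹ : GL (Fin n) (PadicAlgCl p)) : Matrix (Fin n) (Fin n) (PadicAlgCl p)) i j‖ ≤ 1) ∧ (∀ M : Matrix (Fin n) (Fin n) ℤ, M.det = 1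 → ∃ σ : Field.absoluteGaloisGroup K, ∀ i j : Fin n, ‖((g * ρ σ * g⁻¹ : GL (Fin n) (PadicAlgCl p)) : Matrix (Fin n) (Fin n) (PadicAlgCl p)) i j - ((M i j : ℤ) : PadicAlgCl p)‖ < 1)) ∧ (∃ l : ℕ, l.Prime ∧ l ≠ p ∧ ∀ w : HeightOneSpectrum (𝓞 K), ((l : ℕ) : 𝓞 K) ∈ w.asIdeal → w.residueCard = l ∧ ρ.IsUnramifiedAt w ∧ ∃ a : Fin n → PadicAlgCl p, ρ.HasFrobCharpolyAt w (∏ i, (X - C (a i))) ∧ ∀ i j : Fin n, i ≠ j → ‖a i - a j‖ = 1 ∧ ‖a i - (l : PadicAlgCl p) * a j‖ = 1)) → ∀ v : HeightOneSpectrum (𝓞 K), ((p : ℕ) : 𝓞 K) ∉ v.asIdeal → ∀ W : WeilDeligneRep (v.adicCompletion K) (PadicAlgCl p) (Fin n → PadicAlgCl p), IsWeilDeligneOfLadic (ρ.toLocal v).toWeilGroupHom W → ∀ W' : WeilDeligneRep (v.adicCompletion K) (PadicAlgCl p) (Fin n → PadicAlgCl p), W'.IsFrobSemisimplificationOf W →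 (∀ W'' : WeilDeligneRep (v.adicCompletion K) (PadicAlgCl p) (Fin n → PadicAlgCl p), W''.ρ = W'.ρ → Module.finrank (PadicAlgCl p) (LinearMap.range W''.N) ≤ Module.finrank (PadicAlgCl p) (LinearMap.range W'.N)) → ∀ W'' : WeilDeligneRep (v.adicCompletion K) (PadicAlgCl p) (Fin n → PadicAlgCl p), W''.ρ = W'.ρ → ∀ k : ℕ, 2 ≤ k → Module.finrank (PadicAlgCl p) (LinearMap.range (W''.N ^ k)) ≤ Module.finrank (PadicAlgCl p) (LinearMap.range (W'.N ^ k))) := by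
  sorry

-- SKELETON SHAPE (writer-1 g6 fix; also: `stub_depthRungs_reduction` now concludes the crux TEXT verbatim (= the route def body) instead of the route decl name, since a stub of type `… → <RouteDecl>` is itself a by-name candidate): the hypothesised composition `DepthRungs_of (h₁ h₂) := h₂ h₁` is removed so that EXACTLY ONE theorem concludes the route decl (the skeleton audit takes an arbitrary candidate and bounces a hypothesised one as `skeleton.extra-hypothesis`); `DepthRungs_proof` applies the reduction stub to the semistable stub directly.
theorem DepthRungs_proof : Summit.Langlands.Langlands.Theses.MonodromyRankLadder.DepthRungs := by
  -- the reduction stub concludes the crux TEXT (so that it is not itself a by-name candidate for the skeleton audit); the route decl unfolds to it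
  exact stub_depthRungs_reduction stub_depthRungs_semistable

end Summit.Langlands.Langlands.Cruxes.DepthRungs.Birth
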